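/-
Copyright (c) 2026. All rights reserved.
Released under Apache 2.0 license as described in the file LICENSE.
-/
import Summits.HubbardSuperconductivity.HubbardLadder.Bounds.SectorTwistRatioFromCommutator
import Literature.MathematicalPhysics.QuantumLattice.HubbardProjectedCreationCommutator
import HarnessLib

/-!
# The one-particle commutator scale of `H^{tt'}_L` and Theorem 13_N with it (bounds.tex §13)

HONEST FRAMING: ladder R1–R4 with certified numbers; no claim on H/H₀. These are bounds for
MODEL CLASSES (the typed repulsive/attractive `t–t'` Hubbard torus with a flux twist), no
materials claim.

Part #211.18 discharged the walk input of Theorem 13_N with the support-counting commutator rate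
`r = 18 (2 + |U| + 2|t'|)` (`ttCommRate`). This part SHARPENS the rate to the one-particle scale

`r♯(t', U) = 4 + 4|t'| + |U|`  (`ttCommRateSharp`; ninefold in the hopping, eighteenfold in `U`),

and re-derives the log-Lipschitz continuity of the sector weights, the walk input and THEOREM 13_N
with `r♯` in place of `r` — first for ANY rate `r ≥ 0` dominating the `2n` commutator norms
(`…_of_rate` versions, so a future sharper rate plugs in with one line), then for `r♯`:

* generic graph `G` of maximal degree `Δ`: the tree's EXACT commutators
  `[H(t,U), c_{zτ}] = t Σ_{x∼z} c_{xτ} - U n_{z,-τ} c_{zτ}` and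
  `[H(t,U), c†_{zτ}] = -t Σ_{x∼z} c†_{xτ} + U n_{z,-τ} c†_{zτ}`
  (`hamiltonian_mul_{annihilation,creation}_sub`, Tasaki (2020) §9.3) with `‖Σ_{x∼z} c_x‖ ≤ Δ`
  (`norm_sum_ite_adj_le`) and `‖n‖, ‖c‖ ≤ 1` give `‖[H(t,U), c^{(†)}_{zτ}]‖ ≤ Δ|t| + |U|`
  (`norm_commutator_hamiltonian_{annihilation,creation}_le_sharp`);
* torus: `H^{tt'}_L(0) = H(1,U) + H'(t',0)` on two graphs of degree `≤ 4` (split of #211.18),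
  whence `‖[H^{tt'}_L(0), c^{(†)}_o]‖ ≤ (4 + |U|) + 4|t'| = r♯` for every orbital and every `L`.

HONEST SIZE (orientation, not certified, used in no statement): at the window of bounds.tex
`I_c4` (`β(1+|t'|) ≤ 1/1250`, `β|U| ≤ 1/50`) one has `β r♯ ≤ 0.024` (vs `β r ≤ 0.39`), so the
walk exponent `2K_w log C♯ ≈ 16 λ√v β r♯ (1/ρ + 1/(2-ρ)) L` is `≈ 1.0 λ√v · L` at `ρ = 1/2`
against the numerator's `e^{-bL}`, `b = 9/10` (`λ√v ∈ [1, 3/2]` from #211.11): short by a factor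
`≈ 1.1–1.7` only — the remaining factor is the window bookkeeping `K_w ≈ 4K + 2` of
#211.8/#211.12 (a walk of `≈ K` steps would do, worth `≈ 4×`), left to the successor together
with the instance row. No numerics, no `native_decide`; standard axioms only. References:
H. Tasaki, Physics and Mathematics of Quantum Many-Body Systems (2020) §9.3 [Tasaki2020];
D. Ruelle, Statistical Mechanics (1969) §3.4 [Ruelle1969]; programme notes bounds.tex §13.
-/

noncomputable section

namespace Summit.HubbardSuperconductivity.HubbardLadder.Bounds

open Matrix Finset Complex
open Literature.MathematicalPhysics.QuantumLattice
open Literature.MathematicalPhysics.QuantumLattice.HubbardWave0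
open Summit.HubbardSuperconductivity.HubbardSuperconductivity.Theorems.WidthHaldane
open scoped Matrix.Norms.L2Operator ComplexOrder

/-! ### Generic graph: the one-particle commutator scale -/

section Graph

variable {Λ : Type*} [LinearOrder Λ] [Fintype Λ] (G : SimpleGraph Λ) [DecidableRel G.Adj]

/-- **`‖[H(t,U), c_{zτ}]‖ ≤ Δ |t| + |U|`** on a graph of maximal degree `Δ`, uniformly in the
volume (from the exact commutator `t Σ_{x∼z} c_{xτ} - U n_{z,-τ} c_{zτ}`). [Tasaki2020 §9.3;
this file] -/
theorem norm_commutator_hamiltonian_annihilation_le_sharp {Δ : ℕ}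
    (hΔ : ∀ x : Λ, (Finset.univ.filter fun y => G.Adj x y).card ≤ Δ) (t U : ℝ) (z : Λ)
    (τ : Fin 2) :
    ‖hamiltonian G t U * annihilation (orb z τ) - annihilation (orb z τ) * hamiltonian G t U‖ ≤
      Δ * |t| + |U| := by
  obtain ⟨τ', -, h⟩ := hamiltonian_mul_annihilation_sub G t U z τ
  rw [h]
  refine (norm_sub_le _ _).trans (add_le_add ?_ ?_)
  · refine (norm_smul_le _ _).trans ?_
    rw [Complex.norm_real, Real.norm_eq_abs, mul_comm]
    exact mul_le_mul_of_nonneg_right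
      (norm_sum_ite_adj_le G hΔ z _ fun x => norm_annihilation_le_one _) (abs_nonneg _)
  · refine (norm_smul_le _ _).trans ?_
    rw [Complex.norm_real, Real.norm_eq_abs]
    refine (mul_le_mul_of_nonneg_left ?_ (abs_nonneg _)).trans_eq (mul_one _)
    exact (norm_mul_le _ _).trans
      (mul_le_one₀ (norm_numberOp_le_one z τ') (norm_nonneg _) (norm_annihilation_le_one _))

/-- **`‖[H(t,U), c†_{zτ}]‖ ≤ Δ |t| + |U|`** (from `-t Σ_{x∼z} c†_{xτ} + U n_{z,-τ} c†_{zτ}`).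
[Tasaki2020 §9.3; this file] -/
theorem norm_commutator_hamiltonian_creation_le_sharp {Δ : ℕ}
    (hΔ : ∀ x : Λ, (Finset.univ.filter fun y => G.Adj x y).card ≤ Δ) (t U : ℝ) (z : Λ)
    (τ : Fin 2) :
    ‖hamiltonian G t U * creation (orb z τ) - creation (orb z τ) * hamiltonian G t U‖ ≤
      Δ * |t| + |U| := by
  obtain ⟨τ', -, h⟩ := hamiltonian_mul_creation_sub G t U z τ
  rw [h]
  refine (norm_add_le _ _).trans (add_le_add ?_ ?_)
  · refine (norm_smul_le _ _).trans ?_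
    rw [norm_neg, Complex.norm_real, Real.norm_eq_abs, mul_comm]
    exact mul_le_mul_of_nonneg_right
      (norm_sum_ite_adj_le G hΔ z _ fun x => norm_creation_le_one _) (abs_nonneg _)
  · refine (norm_smul_le _ _).trans ?_
    rw [Complex.norm_real, Real.norm_eq_abs]
    refine (mul_le_mul_of_nonneg_left ?_ (abs_nonneg _)).trans_eq (mul_one _)
    exact (norm_mul_le _ _).trans
      (mul_le_one₀ (norm_numberOp_le_one z τ') (norm_nonneg _) (norm_creation_le_one _))

end Graph

/-! ### The torus: `r♯ = 4 + 4|t'| + |U|` -/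

variable {L : ℕ} [NeZero L]

/-- The one-particle commutator rate `r♯(t', U) = 4 + 4|t'| + |U|` of `H^{tt'}_L` (degree `4`
for both graphs, hopping `1` and `t'`). [programme definition: bounds.tex §13, Lemma 13.5′] -/
def ttCommRateSharp (t' U : ℝ) : ℝ := 4 + 4 * |t'| + |U|

/-- `0 ≤ r♯`. [this file] -/
theorem ttCommRateSharp_nonneg (t' U : ℝ) : 0 ≤ ttCommRateSharp t' U := by
  unfold ttCommRateSharp; positivity

/-- **`‖[H^{tt'}_L(0), c_o]‖ ≤ r♯ = 4 + 4|t'| + |U|`** for every orbital and every `L`.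
[this file] -/
theorem norm_commutator_hubbardTorusTT'Flux_zero_annihilation_le_sharp (t' U : ℝ)
    (o : Orb (FermionTorus 2 L)) :
    ‖hubbardTorusTT'Flux L t' U 0 * annihilation o -
        annihilation o * hubbardTorusTT'Flux L t' U 0‖ ≤ ttCommRateSharp t' U := by
  have h1 := norm_commutator_hamiltonian_annihilation_le_sharp (fermionTorusGraph 2 L) (Δ := 4)
    (fun x => SourceGas.card_filter_fermionTorusGraph_adj_le x) 1 U (ofLex o).1 (ofLex o).2
  have h2 := norm_commutator_hamiltonian_annihilation_le_sharp (fermionTorusDiagGraph L) (Δ := 4)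
    (fun x => card_filter_fermionTorusDiagGraph_adj_le x) t' 0 (ofLex o).1 (ofLex o).2
  rw [hubbardTorusTT'Flux_zero, hubbardTorusTT'_commutator_split, hamiltonianWith_zero,
    hamiltonianWith_zero]
  refine (norm_add_le _ _).trans ((add_le_add h1 h2).trans (le_of_eq ?_))
  unfold ttCommRateSharp
  norm_num
  ring

/-- **`‖[H^{tt'}_L(0), c†_o]‖ ≤ r♯`**. [this file] -/
theorem norm_commutator_hubbardTorusTT'Flux_zero_creation_le_sharp (t' U : ℝ)
    (o : Orb (FermionTorus 2 L)) :
    ‖hubbardTorusTT'Flux L t' U 0 * creation o - creation o * hubbardTorusTT'Flux L t' U 0‖ ≤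
      ttCommRateSharp t' U := by
  have h1 := norm_commutator_hamiltonian_creation_le_sharp (fermionTorusGraph 2 L) (Δ := 4)
    (fun x => SourceGas.card_filter_fermionTorusGraph_adj_le x) 1 U (ofLex o).1 (ofLex o).2
  have h2 := norm_commutator_hamiltonian_creation_le_sharp (fermionTorusDiagGraph L) (Δ := 4)
    (fun x => card_filter_fermionTorusDiagGraph_adj_le x) t' 0 (ofLex o).1 (ofLex o).2
  rw [hubbardTorusTT'Flux_zero, hubbardTorusTT'_commutator_split, hamiltonianWith_zero,
    hamiltonianWith_zero]
  refine (norm_add_le _ _).trans ((add_le_add h1 h2).trans (le_of_eq ?_))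
  unfold ttCommRateSharp
  norm_num
  ring

/-! ### Log-Lipschitz continuity and the walk input for any commutator rate -/

/-- LOG-LIPSCHITZ CONTINUITY OF `k ↦ w_k` FOR ANY RATE `r` dominating `‖[H^{tt'}_L(0), c^{(†)}_o]‖`
(`β ≥ 0`, `k < n = |Orb Λ_L|`). [Ruelle1969 §3.4; from `sectorWeight_orbitSum_transfer`] -/
theorem ttSectorWeight_transfer_of_rate {β : ℝ} (hβ : 0 ≤ β) (t' U : ℝ) {r : ℝ}
    (hc : ∀ o : Orb (FermionTorus 2 L),
      ‖hubbardTorusTT'Flux L t' U 0 * creation o - creation o * hubbardTorusTT'Flux L t' U 0‖ ≤ r)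
    (ha : ∀ o : Orb (FermionTorus 2 L),
      ‖hubbardTorusTT'Flux L t' U 0 * annihilation o -
        annihilation o * hubbardTorusTT'Flux L t' U 0‖ ≤ r)
    (k : ℕ) (hk : k < Fintype.card (Orb (FermionTorus 2 L))) :
    ((Fintype.card (Orb (FermionTorus 2 L)) : ℝ) - k) * ttSectorWeight L β t' U k ≤
        Real.exp (β * (Fintype.card (Orb (FermionTorus 2 L)) * r) /
            ((Fintype.card (Orb (FermionTorus 2 L)) : ℝ) - k)) *
          (((k : ℝ) + 1) * ttSectorWeight L β t' U (k + 1)) ∧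
      ((k : ℝ) + 1) * ttSectorWeight L β t' U (k + 1) ≤
        Real.exp (β * (Fintype.card (Orb (FermionTorus 2 L)) * r) / ((k : ℝ) + 1)) *
          (((Fintype.card (Orb (FermionTorus 2 L)) : ℝ) - k) * ttSectorWeight L β t' U k) := by
  have hw : ∀ m : ℕ,
      ∑ s ∈ (Finset.univ.filter fun s : Finset (Orb (FermionTorus 2 L)) => s.card = m),
        (gibbsWeight β (hubbardTorusTT'Flux L t' U 0) s s).re = ttSectorWeight L β t' U m := by
    intro m
    rw [ttSectorWeight, ttSectorZ_eq_sum, Complex.re_sum]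
  have h := sectorWeight_orbitSum_transfer (hubbardTorusTT'Flux L t' U 0)
    (isHermitian_hubbardTorusTT'Flux L t' U 0)
    (card_eq_of_preservesSectors (preservesSectors_hubbardTorusTT'Flux L t' U 0)) hβ hc ha k hk
  rwa [hw, hw] at h

/-- THE WALK INPUT OF #211.8 FOR ANY COMMUTATOR RATE `r` (`G = log C`,
`C = transferWalkConstant n N K_w (β n r) s`). [this file] -/
theorem tt_walk_input_of_rate {β : ℝ} (hβ : 0 ≤ β) (t' U s : ℝ) {r : ℝ}
    (hc : ∀ o : Orb (FermionTorus 2 L),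
      ‖hubbardTorusTT'Flux L t' U 0 * creation o - creation o * hubbardTorusTT'Flux L t' U 0‖ ≤ r)
    (ha : ∀ o : Orb (FermionTorus 2 L),
      ‖hubbardTorusTT'Flux L t' U 0 * annihilation o -
        annihilation o * hubbardTorusTT'Flux L t' U 0‖ ≤ r)
    (hr : 0 ≤ r) {K K₀ : ℝ} (hK : 0 < K)
    (hV : gcVar (ttSectorWeight L β t' U) (Fintype.card (Orb (FermionTorus 2 L))) s ≤ K ^ 2 / 4)
    {N Kw : ℕ}
    (hm : |gcMean (ttSectorWeight L β t' U) (Fintype.card (Orb (FermionTorus 2 L))) s - N| ≤ K₀)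
    (hKw : K₀ + 2 * K + 2 ≤ Kw) (hKwN : Kw ≤ N)
    (hNn : N + Kw ≤ Fintype.card (Orb (FermionTorus 2 L))) :
    0 ≤ Real.log (transferWalkConstant (Fintype.card (Orb (FermionTorus 2 L))) N Kw
        (β * (Fintype.card (Orb (FermionTorus 2 L)) * r)) s) ∧
      ∀ k : ℕ, N - Kw ≤ k → k + 1 ≤ min (N + Kw) (Fintype.card (Orb (FermionTorus 2 L))) →
        Real.exp (s * (k + 1 : ℕ)) * ttSectorWeight L β t' U (k + 1) ≤
            Real.exp (Real.log (transferWalkConstant (Fintype.card (Orb (FermionTorus 2 L))) N Kw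
              (β * (Fintype.card (Orb (FermionTorus 2 L)) * r)) s)) *
              (Real.exp (s * k) * ttSectorWeight L β t' U k) ∧
          Real.exp (s * k) * ttSectorWeight L β t' U k ≤
            Real.exp (Real.log (transferWalkConstant (Fintype.card (Orb (FermionTorus 2 L))) N Kw
              (β * (Fintype.card (Orb (FermionTorus 2 L)) * r)) s)) *
              (Real.exp (s * (k + 1 : ℕ)) * ttSectorWeight L β t' U (k + 1)) := by
  have hw : ∀ k ≤ Fintype.card (Orb (FermionTorus 2 L)), 0 < ttSectorWeight L β t' U k :=
    fun k hk => ttSectorWeight_pos β t' U hk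
  have hb : 0 ≤ β * (Fintype.card (Orb (FermionTorus 2 L)) * r) :=
    mul_nonneg hβ (mul_nonneg (Nat.cast_nonneg _) hr)
  exact walk_input_of_transfer hw s hK hV hb
    (fun k hk => ttSectorWeight_transfer_of_rate hβ t' U hc ha k (by omega)) hm hKw hKwN hNn

/-! ### Theorem 13_N with the one-particle rate -/

/-- **THEOREM 13_N, WALK DISCHARGED AT THE ONE-PARTICLE SCALE.** The statement of
`norm_ttSectorZ_twist_sub_le_of_commutator` (#211.18) with the walk constant
`C♯ = transferWalkConstant n N K_w (β n r♯(t',U)) s`, `r♯ = 4 + 4|t'| + |U|`, in place of `C`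
(`r = 18(2 + |U| + 2|t'|)`): same hypotheses (numerator smallness, atomic non-vanishing,
Chebyshev window data), a nine-to-eighteenfold smaller walk exponent. [programme: bounds.tex §13
Theorem 13_N, Lemma 13.5′; this file] -/
theorem norm_ttSectorZ_twist_sub_le_sharp (hL : 3 ≤ L) {β : ℝ} (hβ : 0 < β) (t' U θ : ℝ)
    {M N : ℕ} (hM : Fintype.card (Orb (FermionTorus 2 L)) < M) (hN : N < M) (s : ℝ)
    (hz : ∀ k ∈ Finset.range M,
      atomicPartitionFn (β : ℂ) (U : ℂ) (fourierPoint M (s : ℂ) k / β) ≠ 0)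
    {c₀ u₀ R a δ F : ℝ} (hc₀ : 0 ≤ c₀) (hc1 : c₀ ≤ 1) (hv : |β * U| ≤ u₀) (hR : 0 < R)
    (hfloor : 1 ≤ R ^ 2 * (1 - (1 - c₀) / 2 - (1 - c₀ ^ 2) / (1 + Real.exp (-(u₀ / 2))) ^ 2))
    (ha : 0 < a) (hδ : 0 < δ)
    (hsmall : 16 * (|β| * (1 + |t'|)) * Real.exp (2 * (|β| * (1 + |t'|))) *
      (R * Real.exp (a + δ) + a) ^ 2 ≤ a)
    (hF : Real.exp (offArcRate c₀ u₀ (β * U) s) +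
      16 * (|β| * (1 + |t'|)) * Real.exp (2 * (|β| * (1 + |t'|))) * F ^ 2 ≤ F)
    {K V K₀ : ℝ} {Kw : ℕ} (hK : 1 ≤ K)
    (hV : gcVar (ttSectorWeight L β t' U) (Fintype.card (Orb (FermionTorus 2 L))) s ≤ V)
    (hVK : V < K ^ 2)
    (hm : |gcMean (ttSectorWeight L β t' U) (Fintype.card (Orb (FermionTorus 2 L))) s - N| ≤ K₀)
    (hKw : K₀ + 4 * K + 2 ≤ Kw) (hKwN : Kw ≤ N)
    (hNKw : N + Kw ≤ Fintype.card (Orb (FermionTorus 2 L))) :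
    ‖ttSectorZ L β t' U θ N - ttSectorZ L β t' U 0 N‖ ≤
      (2 * K + 1) *
            transferWalkConstant (Fintype.card (Orb (FermionTorus 2 L))) N Kw
                (β * (Fintype.card (Orb (FermionTorus 2 L)) * ttCommRateSharp t' U)) s ^ (2 * Kw) /
          (1 - V / K ^ 2) *
        ((Real.exp (2 * a * (L : ℝ) ^ 2 * Real.exp (-(δ * L))) - 1) +
          2 * (atomicZ (β * U) s ^ Fintype.card (FermionTorus 2 L) *
            Real.exp ((F - Real.exp (offArcRate c₀ u₀ (β * U) s) - offArcRate c₀ u₀ (β * U) s) *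
              Fintype.card (FermionTorus 2 L))) /
            gcSum (ttSectorWeight L β t' U) (Fintype.card (Orb (FermionTorus 2 L))) s) *
        (ttSectorZ L β t' U 0 N).re := by
  have hK' : (0 : ℝ) < 2 * K := by linarith
  have hV' : gcVar (ttSectorWeight L β t' U) (Fintype.card (Orb (FermionTorus 2 L))) s ≤
      (2 * K) ^ 2 / 4 := by nlinarith
  have hKw' : K₀ + 2 * (2 * K) + 2 ≤ Kw := by linarith
  obtain ⟨hG, hadj⟩ := tt_walk_input_of_rate hβ.le t' U s
    (norm_commutator_hubbardTorusTT'Flux_zero_creation_le_sharp t' U)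
    (norm_commutator_hubbardTorusTT'Flux_zero_annihilation_le_sharp t' U)
    (ttCommRateSharp_nonneg t' U) hK' hV' hm hKw' hKwN hNKw
  have h := norm_ttSectorZ_twist_sub_le hL hβ.ne' t' U θ hM hN (by omega) s hz hc₀ hc1 hv hR
    hfloor ha hδ hsmall hF hK hV hVK hm (by linarith) hG hadj
  have hKw1 : 1 ≤ Kw := by
    have hK₀ : 0 ≤ K₀ := (abs_nonneg _).trans hm
    have : (1 : ℝ) ≤ Kw := by linarith
    exact_mod_cast this
  rwa [Real.exp_log (transferWalkConstant_pos _ s hKw1 hNKw)] at h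

end Summit.HubbardSuperconductivity.HubbardLadder.Bounds
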